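import Summits.ValiantsHypothesis.ValiantsHypothesis.Theorems.SymPencilPerFourHessianMinors

/-!
# Route `SymPencil` — the pairing discriminant vanishes on no hyperplane of `K⁴ × K⁴`
# (the algebraic half of the exclusion of `(r, dim V) = (9, 7)` at defects `6, 7`;
# `--supports` stmt-ValiantsHypothesis-5674 `SdcSuperquadratic`; rung currency only)

Coordinates on `K⁸ = K^{Fin 4 ⊕ Fin 4}`: `α_i = Y (inl i)`, `β_i = Y (inr i)` (the two rows of a
`2 × 4` matrix).  The PAIRING DISCRIMINANT of `SymPencilPerFourRowPairing` is
`A·B - 4 Π` with `A = Σ_j α_j Π_{i≠j} β_i`, `B = Σ_j β_j Π_{i≠j} α_i`, `Π = Π_i α_i β_i`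
(`= -¼ det` of the `4 × 4` row-pairing matrix).

**Theorem** (`false_of_pairingDisc_vanish`).  No linear subspace `V' ≤ K⁸` of dimension `≥ 7`
has `A·B = 4 Π` identically on `V'`.

Proof.  For an ordered pair `j ≠ l` restrict to `W = V' ∩ {α_l = β_j = 0}` (`dim W ≥ 5`): there
`Π = 0`, `A = α_j Π_{i≠j} β_i`, `B = β_l Π_{i≠l} α_i`, so a product of eight COORDINATE functionals
vanishes on `W`, hence (a product of linear forms vanishing on a subspace has a factor vanishing on
it — `exists_forall_eq_zero_of_prod_eq_zero`, from val-width-5674-p2's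
`SymPencilPerFourHessianMinors.exists_ne_zero_and_ne_zero`) one coordinate `x ∉ {α_l, β_j}`
vanishes on `W`; then `W` lies in the span of the remaining five unit vectors, has dimension `5`,
and IS that span: `V'` contains every unit vector `e_c`, `c ∉ {α_l, β_j, x}`
(`single_mem_of_pairingDisc_vanish`).  Running over all ordered pairs, at most one unit vector is
missing from `V'` (any two coordinates avoid `{α_l, β_j}` for a suitable pair — `exists_pair_avoiding`,
`decide`), so `V' ∋ 𝟙 - e_m` for some `m`, where `A·B - 4Π = 3 ≠ 0` (`pairingDisc_indicator`).

Use: `SymPencilPerFourLowRankSevenSharp` (a `7`-dimensional singular subspace with a detecting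
pair of rows projects onto such a `V'`).  Honest framing: linear algebra; nothing here changes
`sdc(per_4) ≥ 25`; the crux `SdcSuperquadratic` and `VP ≠ VNP` are untouched.  No definitions, no
named facts. [folklore]
-/

noncomputable section

-- single-conjunct layout: Sub = Summit, duplicated namespace component intended
set_option linter.dupNamespace false

namespace Summit.ValiantsHypothesis.ValiantsHypothesis.Theorems.SymPencilPerFourPairingHyperplane

open Finset Module Polynomial
open Literature.Computability.AlgebraicComplexity
open Literature.Computability.AlgebraicComplexity.AlperBogartVelasco
open Summit.ValiantsHypothesis.ValiantsHypothesis.Theorems.SymPencilPerFourHessianMinors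

variable {K : Type*} [Field K]

/-! ### Products of linear forms vanishing on a subspace -/

/-- If each of finitely many linear forms is non-zero somewhere on a subspace `W` (infinite
field), some point of `W` makes all of them non-zero. [folklore] -/
theorem exists_mem_forall_ne_zero [Infinite K] {M : Type*} [AddCommGroup M] [Module K M]
    (W : Submodule K M) {ι' : Type*} [DecidableEq ι'] (f : ι' → (M →ₗ[K] K)) (s : Finset ι')
    (hs : ∀ i ∈ s, ∃ y ∈ W, f i y ≠ 0) : ∃ y ∈ W, ∀ i ∈ s, f i y ≠ 0 := by
  classical
  induction s using Finset.induction_on with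
  | empty => exact ⟨0, W.zero_mem, fun i hi => absurd hi (Finset.notMem_empty i)⟩
  | @insert a s ha ih =>
    obtain ⟨y₁, hy₁, hne₁⟩ := ih fun i hi => hs i (Finset.mem_insert_of_mem hi)
    obtain ⟨y₂, hy₂, hne₂⟩ := hs a (Finset.mem_insert_self a s)
    -- the product over `s` and the form `f a` are polynomial along lines
    have hlin : ∀ (g : M →ₗ[K] K) (y₀ y : M), ∃ p : K[X], ∀ t : K,
        g (y₀ + t • y) = p.eval t := fun g y₀ y =>
      ⟨Polynomial.C (g y₀) + Polynomial.C (g y) * Polynomial.X, fun t => by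
        simp only [map_add, map_smul, smul_eq_mul, Polynomial.eval_add, Polynomial.eval_mul,
          Polynomial.eval_C, Polynomial.eval_X]
        ring⟩
    have hprod : ∀ y₀ y : M, ∃ p : K[X], ∀ t : K,
        (fun z => ∏ i ∈ s, f i z) (y₀ + t • y) = p.eval t := fun y₀ y =>
      ⟨∏ i ∈ s, (Polynomial.C (f i y₀) + Polynomial.C (f i y) * Polynomial.X), fun t => by
        rw [Polynomial.eval_prod]
        exact Finset.prod_congr rfl fun i _ => by
          simp only [map_add, map_smul, smul_eq_mul, Polynomial.eval_add, Polynomial.eval_mul,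
            Polynomial.eval_C, Polynomial.eval_X]
          ring⟩
    have hF₁ : (fun z => ∏ i ∈ s, f i z) y₁ ≠ 0 := Finset.prod_ne_zero_iff.2 hne₁
    obtain ⟨y, hy, hFy, hay⟩ :=
      exists_ne_zero_and_ne_zero W (f := fun z => ∏ i ∈ s, f i z) (g := fun z => f a z)
        hprod (hlin (f a)) hy₁ hy₂ hF₁ hne₂
    refine ⟨y, hy, fun i hi => ?_⟩
    rcases Finset.mem_insert.1 hi with rfl | hi
    · exact hay
    · exact (Finset.prod_ne_zero_iff.1 hFy) i hi

/-- **A product of linear forms vanishing identically on a subspace has a factor vanishing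
identically on it** (infinite field). [folklore] -/
theorem exists_forall_eq_zero_of_prod_eq_zero [Infinite K] {M : Type*} [AddCommGroup M]
    [Module K M] (W : Submodule K M) {ι' : Type*} [DecidableEq ι'] (f : ι' → (M →ₗ[K] K))
    (s : Finset ι') (H : ∀ y ∈ W, ∏ i ∈ s, f i y = 0) : ∃ i ∈ s, ∀ y ∈ W, f i y = 0 := by
  by_contra hne
  push Not at hne
  obtain ⟨y, hy, hall⟩ := exists_mem_forall_ne_zero W f s hne
  exact Finset.prod_ne_zero_iff.2 hall (H y hy)

/-! ### One ordered pair of indices -/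

/-- For `j ≠ l`: if `A·B = 4Π` on `V'` (coordinates `α = Y ∘ inl`, `β = Y ∘ inr`) and
`dim V' ≥ 7`, then for some coordinate `x ∉ {α_l, β_j}` every unit vector `e_c` with
`c ∉ {α_l, β_j, x}` lies in `V'`.  See the module docstring. [folklore] -/
theorem single_mem_of_pairingDisc_vanish [CharZero K] (V' : Submodule K (Fin 4 ⊕ Fin 4 → K))
    (h7 : 7 ≤ finrank K V')
    (hdisc : ∀ Y ∈ V',
      (∑ j, ∏ i, if i = j then Y (Sum.inl i) else Y (Sum.inr i)) *
        (∑ j, ∏ i, if i = j then Y (Sum.inr i) else Y (Sum.inl i)) =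
        4 * ∏ i, Y (Sum.inl i) * Y (Sum.inr i))
    (j l : Fin 4) (hjl : j ≠ l) :
    ∃ x : Fin 4 ⊕ Fin 4, x ≠ Sum.inl l ∧ x ≠ Sum.inr j ∧
      ∀ c : Fin 4 ⊕ Fin 4, c ≠ Sum.inl l → c ≠ Sum.inr j → c ≠ x →
        (Pi.single c 1 : Fin 4 ⊕ Fin 4 → K) ∈ V' := by
  classical
  -- the slice `W = V' ∩ {α_l = 0, β_j = 0}`, of dimension `≥ 5`
  let πl : (Fin 4 ⊕ Fin 4 → K) →ₗ[K] K := LinearMap.proj (Sum.inl l)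
  let πj : (Fin 4 ⊕ Fin 4 → K) →ₗ[K] K := LinearMap.proj (Sum.inr j)
  set W : Submodule K (Fin 4 ⊕ Fin 4 → K) := V' ⊓ LinearMap.ker πl ⊓ LinearMap.ker πj with hWdef
  have hWle : W ≤ V' := fun Y hY => (Submodule.mem_inf.1 (Submodule.mem_inf.1 hY).1).1
  have memW : ∀ Y ∈ W, Y ∈ V' ∧ Y (Sum.inl l) = 0 ∧ Y (Sum.inr j) = 0 := fun Y hY => by
    rw [hWdef, Submodule.mem_inf, Submodule.mem_inf, LinearMap.mem_ker, LinearMap.mem_ker] at hY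
    exact ⟨hY.1.1, hY.1.2, hY.2⟩
  have hW5 : 5 ≤ finrank K W := by
    have h1 := finrank_eq_finrank_map_add_finrank_inf_ker V' πl
    have h2 := finrank_eq_finrank_map_add_finrank_inf_ker (V' ⊓ LinearMap.ker πl) πj
    have hb1 : finrank K (V'.map πl) ≤ 1 :=
      ((V'.map πl).finrank_le).trans (Module.finrank_self K).le
    have hb2 : finrank K ((V' ⊓ LinearMap.ker πl).map πj) ≤ 1 :=
      (((V' ⊓ LinearMap.ker πl).map πj).finrank_le).trans (Module.finrank_self K).le
    rw [hWdef]
    omega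
  -- on `W` the discriminant is a product of eight coordinate functionals
  let σa : Fin 4 → Fin 4 ⊕ Fin 4 := fun i => if i = j then Sum.inl i else Sum.inr i
  let σb : Fin 4 → Fin 4 ⊕ Fin 4 := fun i => if i = l then Sum.inr i else Sum.inl i
  let f : Fin 4 ⊕ Fin 4 → ((Fin 4 ⊕ Fin 4 → K) →ₗ[K] K) :=
    fun t => Sum.elim (fun i => LinearMap.proj (σa i)) (fun i => LinearMap.proj (σb i)) t
  have hfa : ∀ i Y, f (Sum.inl i) Y = Y (σa i) := fun _ _ => rfl
  have hfb : ∀ i Y, f (Sum.inr i) Y = Y (σb i) := fun _ _ => rfl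
  have hprod : ∀ Y ∈ W, ∏ t ∈ (Finset.univ : Finset (Fin 4 ⊕ Fin 4)), f t Y = 0 := by
    intro Y hY
    obtain ⟨hYV, hαl, hβj⟩ := memW Y hY
    have hA : (∑ j', ∏ i, if i = j' then Y (Sum.inl i) else Y (Sum.inr i)) =
        ∏ i, Y (σa i) := by
      rw [Finset.sum_eq_single j]
      · exact Finset.prod_congr rfl fun i _ => by
          by_cases hij : i = j
          · simp [σa, hij]
          · simp [σa, hij]
      · intro j' _ hj'
        exact Finset.prod_eq_zero (Finset.mem_univ j) (by rw [if_neg (Ne.symm hj'), hβj])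
      · intro h; exact absurd (Finset.mem_univ j) h
    have hB : (∑ j', ∏ i, if i = j' then Y (Sum.inr i) else Y (Sum.inl i)) =
        ∏ i, Y (σb i) := by
      rw [Finset.sum_eq_single l]
      · exact Finset.prod_congr rfl fun i _ => by
          by_cases hil : i = l
          · simp [σb, hil]
          · simp [σb, hil]
      · intro j' _ hj'
        exact Finset.prod_eq_zero (Finset.mem_univ l) (by rw [if_neg (Ne.symm hj'), hαl])
      · intro h; exact absurd (Finset.mem_univ l) h
    have hPi : ∏ i, Y (Sum.inl i) * Y (Sum.inr i) = 0 :=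
      Finset.prod_eq_zero (Finset.mem_univ l) (by rw [hαl, zero_mul])
    have h := hdisc Y hYV
    rw [hA, hB, hPi, mul_zero] at h
    rw [Fintype.prod_sum_type]
    simpa [hfa, hfb] using h
  obtain ⟨t, -, ht⟩ := exists_forall_eq_zero_of_prod_eq_zero W f Finset.univ hprod
  -- the vanishing coordinate `x`
  obtain ⟨x, hx, hxl, hxj⟩ : ∃ x : Fin 4 ⊕ Fin 4, (∀ Y ∈ W, Y x = 0) ∧
      x ≠ Sum.inl l ∧ x ≠ Sum.inr j := by
    rcases t with i | i
    · refine ⟨σa i, fun Y hY => by have h := ht Y hY; rwa [hfa] at h, ?_, ?_⟩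
      · by_cases hij : i = j
        · simp only [σa, if_pos hij, Ne, Sum.inl.injEq]; exact hij ▸ hjl
        · simp [σa, hij]
      · by_cases hij : i = j
        · simp [σa, hij]
        · simp only [σa, if_neg hij, Ne, Sum.inr.injEq]; exact hij
    · refine ⟨σb i, fun Y hY => by have h := ht Y hY; rwa [hfb] at h, ?_, ?_⟩
      · by_cases hil : i = l
        · simp [σb, hil]
        · simp only [σb, if_neg hil, Ne, Sum.inl.injEq]; exact hil
      · by_cases hil : i = l
        · simp only [σb, if_pos hil, Ne, Sum.inr.injEq]; exact hil ▸ hjl.symm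
        · simp [σb, hil]
  refine ⟨x, hxl, hxj, ?_⟩
  -- `W` is the span of the five remaining unit vectors
  set T : Finset (Fin 4 ⊕ Fin 4) :=
    ((Finset.univ.erase (Sum.inl l)).erase (Sum.inr j)).erase x with hTdef
  have hTcard : T.card = 5 := by
    have hlj : (Sum.inr j : Fin 4 ⊕ Fin 4) ∈ Finset.univ.erase (Sum.inl l) :=
      Finset.mem_erase.2 ⟨by simp, Finset.mem_univ _⟩
    have hxm : x ∈ (Finset.univ.erase (Sum.inl l)).erase (Sum.inr j) :=
      Finset.mem_erase.2 ⟨hxj, Finset.mem_erase.2 ⟨hxl, Finset.mem_univ _⟩⟩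
    rw [hTdef, Finset.card_erase_of_mem hxm, Finset.card_erase_of_mem hlj,
      Finset.card_erase_of_mem (Finset.mem_univ _), Finset.card_univ, Fintype.card_sum,
      Fintype.card_fin]
  have memT : ∀ c, c ∈ T ↔ c ≠ Sum.inl l ∧ c ≠ Sum.inr j ∧ c ≠ x := fun c => by
    rw [hTdef]
    simp only [Finset.mem_erase, Finset.mem_univ, and_true]
    tauto
  set C : Submodule K (Fin 4 ⊕ Fin 4 → K) :=
    Submodule.span K ↑(T.image fun c => (Pi.single c (1 : K) : Fin 4 ⊕ Fin 4 → K)) with hCdef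
  have hCle : finrank K C ≤ 5 := by
    rw [hCdef]
    exact (finrank_span_finset_le_card _).trans (Finset.card_image_le.trans hTcard.le)
  have hWC : W ≤ C := by
    intro Y hY
    obtain ⟨-, hαl, hβj⟩ := memW Y hY
    have hY0 : ∀ c, c ∉ T → Y c = 0 := by
      intro c hc
      rw [memT] at hc
      push Not at hc
      by_cases h1 : c = Sum.inl l
      · rw [h1]; exact hαl
      by_cases h2 : c = Sum.inr j
      · rw [h2]; exact hβj
      rw [hc h1 h2]; exact hx Y hY
    have hdecomp : Y = ∑ c ∈ T, Y c • (Pi.single c (1 : K) : Fin 4 ⊕ Fin 4 → K) :=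
      calc Y = ∑ c, (Pi.single c (Y c) : Fin 4 ⊕ Fin 4 → K) := (Finset.univ_sum_single Y).symm
        _ = ∑ c ∈ T, (Pi.single c (Y c) : Fin 4 ⊕ Fin 4 → K) := by
          symm
          refine Finset.sum_subset (Finset.subset_univ T) fun c _ hc => ?_
          rw [hY0 c hc, Pi.single_zero]
        _ = ∑ c ∈ T, Y c • (Pi.single c (1 : K) : Fin 4 ⊕ Fin 4 → K) :=
          Finset.sum_congr rfl fun c _ => by
            ext c'
            by_cases hc : c' = c
            · subst hc; simp
            · simp [hc]
    rw [hdecomp]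
    refine Submodule.sum_mem _ fun c hc => Submodule.smul_mem _ _ ?_
    rw [hCdef]
    exact Submodule.subset_span (Finset.mem_coe.2 (Finset.mem_image_of_mem _ hc))
  have hWeq : W = C := Submodule.eq_of_le_of_finrank_le hWC (hCle.trans hW5)
  intro c hcl hcj hcx
  have hcT : c ∈ T := (memT c).2 ⟨hcl, hcj, hcx⟩
  have hcC : (Pi.single c (1 : K) : Fin 4 ⊕ Fin 4 → K) ∈ C := by
    rw [hCdef]
    exact Submodule.subset_span (Finset.mem_coe.2 (Finset.mem_image_of_mem _ hcT))
  rw [← hWeq] at hcC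
  exact hWle hcC

/-! ### All pairs: at most one unit vector is missing -/

/-- Any two coordinates of `Fin 4 ⊕ Fin 4` avoid `{inl l, inr j}` for some `j ≠ l`. [folklore] -/
theorem exists_pair_avoiding (c c' : Fin 4 ⊕ Fin 4) :
    ∃ j l : Fin 4, j ≠ l ∧ c ≠ Sum.inl l ∧ c ≠ Sum.inr j ∧ c' ≠ Sum.inl l ∧ c' ≠ Sum.inr j := by
  revert c c'
  decide

/-- **The discriminant at an indicator `𝟙 - e_m`** is `3 ≠ 0 = 4Π`. [folklore] -/
theorem pairingDisc_indicator [CharZero K] (m : Fin 4 ⊕ Fin 4) :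
    (∑ j, ∏ i, if i = j then (if Sum.inl i = m then (0 : K) else 1)
        else (if Sum.inr i = m then (0 : K) else 1)) *
      (∑ j, ∏ i, if i = j then (if Sum.inr i = m then (0 : K) else 1)
        else (if Sum.inl i = m then (0 : K) else 1)) ≠
      4 * ∏ i, (if Sum.inl i = m then (0 : K) else 1) * (if Sum.inr i = m then (0 : K) else 1) := by
  rcases m with i | i <;> fin_cases i <;>
    simp [Fin.sum_univ_four, Fin.prod_univ_four] <;> norm_num

/-- **No `7`-dimensional subspace of `K⁴ × K⁴` on which the pairing discriminant vanishes.**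
See the module docstring. [folklore] -/
theorem false_of_pairingDisc_vanish [CharZero K] (V' : Submodule K (Fin 4 ⊕ Fin 4 → K))
    (h7 : 7 ≤ finrank K V')
    (hdisc : ∀ Y ∈ V',
      (∑ j, ∏ i, if i = j then Y (Sum.inl i) else Y (Sum.inr i)) *
        (∑ j, ∏ i, if i = j then Y (Sum.inr i) else Y (Sum.inl i)) =
        4 * ∏ i, Y (Sum.inl i) * Y (Sum.inr i)) : False := by
  classical
  -- at most one unit vector is missing from `V'`
  have hone : ∃ m : Fin 4 ⊕ Fin 4, ∀ c, c ≠ m → (Pi.single c 1 : Fin 4 ⊕ Fin 4 → K) ∈ V' := by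
    by_cases hall : ∀ c, (Pi.single c 1 : Fin 4 ⊕ Fin 4 → K) ∈ V'
    · exact ⟨Sum.inl 0, fun c _ => hall c⟩
    push Not at hall
    obtain ⟨c₀, hc₀⟩ := hall
    refine ⟨c₀, fun c hc => ?_⟩
    by_contra hcV
    obtain ⟨j, l, hjl, h1, h2, h3, h4⟩ := exists_pair_avoiding c c₀
    obtain ⟨x, -, -, hx⟩ := single_mem_of_pairingDisc_vanish V' h7 hdisc j l hjl
    have hcx : c = x := by
      by_contra h
      exact hcV (hx c h1 h2 h)
    have hc₀x : c₀ = x := by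
      by_contra h
      exact hc₀ (hx c₀ h3 h4 h)
    exact hc (hcx.trans hc₀x.symm)
  obtain ⟨m, hm⟩ := hone
  -- the indicator `𝟙 - e_m` lies in `V'`
  set Y : Fin 4 ⊕ Fin 4 → K := fun c => if c = m then 0 else 1 with hYdef
  have hY : Y ∈ V' := by
    have hsum : Y = ∑ c ∈ Finset.univ.erase m, (Pi.single c (1 : K) : Fin 4 ⊕ Fin 4 → K) := by
      ext c'
      rw [Finset.sum_apply]
      by_cases h : c' = m
      · simp [hYdef, Pi.single_apply, h, Finset.sum_ite_eq]
      · simp [hYdef, Pi.single_apply, h, Finset.sum_ite_eq]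
    rw [hsum]
    exact Submodule.sum_mem _ fun c hc => hm c (Finset.mem_erase.1 hc).1
  have h := hdisc Y hY
  simp only [hYdef] at h
  exact pairingDisc_indicator m h

end Summit.ValiantsHypothesis.ValiantsHypothesis.Theorems.SymPencilPerFourPairingHyperplane

end
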